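import Summits.ResolutionOfSingularities.ResolutionOfSingularities.Theorems.PurelyInseparableDim4JointTwoChartComputations
import Summits.ResolutionOfSingularities.ResolutionOfSingularities.Theorems.PurelyInseparableDim4JointForestInstance
import HarnessLib

/-!
# Purely inseparable four-folds: computations for the LEAF instance `z^p + x₁^p·Q`, `Q = x₁^p x₂ + x₂^p x₃ + x₃^p x₄ + x₄^p x₁`,
# of the monotone joint forest — a 3-fold centre followed by ONE POINT (brick S3 (c) «joint point∘coordinate chains», part 24a,
# cell `res-dim4-pi`)

[OURS · counted 0] (D-0157 DOOR 2; desk WORD #66 (4)(c), #74 (g), #99 (d); frame `PIDim4.TerminationImpliesOrderReduction`,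
S3 (c); host item stmt-ResolutionOfSingularities-16155, helper). Nothing here proves resolution of singularities in
dimension ≥ 4 / characteristic `p` — NOT here, not anywhere in this programme.

`F = x₁^p · Q` over `K` of characteristic `p ≥ 3`. The closed order-`p` points of `z^p + F` form the 3-fold `{x₁ = 0}` (`roots_inst₆`:
`∂F/∂x₂ = x₁^{2p}`); in the chart `x₁` of its blow-up the transform is `Q` (`chartTransform_inst₆`), whose only equimultiple point on the
exceptional hyperplane is the ORIGIN (`eq_zero_of_isEquimultiplePoint_inst₆`: `∂Q/∂x₃ = x₂^p`, `∂Q/∂x₄ = x₃^p`, `∂Q/∂x₁ = x₄^p`) — a LEAF,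
handed to the point regime with state `Q` (`step_F_inst₆`). The POINT blow-up of `z^p + Q` (no equimultiple point in
any chart) is part 24b (`…JointLeafPointCharts`); the certificate is part 24c.

AI-produced formalisation, weaker than expert review. bears_on: LADDER-RESOLUTION:D157-DOOR2 (res-dim4-pi · S3 (c) joint v2 · leaf
instance, computations).
-/

set_option linter.dupNamespace false -- D-0017: single-problem summit path `Summit.<S>.<S>.…` by design

noncomputable section

open MvPolynomial Finset CategoryTheory AlgebraicGeometry Opposite TopologicalSpace

namespace Summit.ResolutionOfSingularities.ResolutionOfSingularities.Theorems.PIDim4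

open Literature.AlgebraicGeometry.Resolution
open Literature.AlgebraicGeometry.Resolution.Hauser2010
open Literature.AlgebraicGeometry.Resolution.AffinePointBlowup (P A γ coord Wtop ξ)

namespace Equimultiple

section Instance₆

variable {K : Type} [Field K] {p : ℕ} [hp : Fact p.Prime] [CharP K p]

/-! ## §1 The cyclic form `Q = x₁^p x₂ + x₂^p x₃ + x₃^p x₄ + x₄^p x₁` -/

omit hp [CharP K p] in
/-- `Q` as a sum of four monomials. [folklore] -/
theorem Q_eq_monomial_add :
    (X 0 ^ p * X 1 + X 1 ^ p * X 2 + X 2 ^ p * X 3 + X 3 ^ p * X 0 : MvPolynomial (Fin 4) K) =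
      monomial (Finsupp.single 0 p + Finsupp.single 1 1) 1 + monomial (Finsupp.single 1 p + Finsupp.single 2 1) 1 +
        monomial (Finsupp.single 2 p + Finsupp.single 3 1) 1 + monomial (Finsupp.single 3 p + Finsupp.single 0 1) 1 := by
  rw [X_pow_mul_X_eq_monomial, X_pow_mul_X_eq_monomial, X_pow_mul_X_eq_monomial, X_pow_mul_X_eq_monomial]

omit hp [CharP K p] in
/-- The support of `Q` lies in its four exponents. [folklore] -/
theorem mem_support_Q {d : Fin 4 →₀ ℕ}
    (hd : d ∈ (X 0 ^ p * X 1 + X 1 ^ p * X 2 + X 2 ^ p * X 3 + X 3 ^ p * X 0 : MvPolynomial (Fin 4) K).support) :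
    d = Finsupp.single 0 p + Finsupp.single 1 1 ∨ d = Finsupp.single 1 p + Finsupp.single 2 1 ∨
      d = Finsupp.single 2 p + Finsupp.single 3 1 ∨ d = Finsupp.single 3 p + Finsupp.single 0 1 := by
  rw [Q_eq_monomial_add] at hd
  rcases Finset.mem_union.mp (Finset.mem_of_subset MvPolynomial.support_add hd) with h₁ | h₁
  · rcases Finset.mem_union.mp (Finset.mem_of_subset MvPolynomial.support_add h₁) with h₂ | h₂
    · rcases Finset.mem_union.mp (Finset.mem_of_subset MvPolynomial.support_add h₂) with h₃ | h₃
      · exact Or.inl (Finset.mem_singleton.mp (Finset.mem_of_subset support_monomial_subset h₃))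
      · exact Or.inr (Or.inl (Finset.mem_singleton.mp (Finset.mem_of_subset support_monomial_subset h₃)))
    · exact Or.inr (Or.inr (Or.inl (Finset.mem_singleton.mp (Finset.mem_of_subset support_monomial_subset h₂))))
  · exact Or.inr (Or.inr (Or.inr (Finset.mem_singleton.mp (Finset.mem_of_subset support_monomial_subset h₁))))

omit [CharP K p] in
/-- `Q` is clean. [cite: HauserPerlega2019PRIMS, §2 (cleaning)] -/
theorem isClean_Q :
    Literature.Barriers.ResolutionOfSingularities.HauserPerlega.IsClean p
      (X 0 ^ p * X 1 + X 1 ^ p * X 2 + X 2 ^ p * X 3 + X 3 ^ p * X 0 : MvPolynomial (Fin 4) K) := by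
  intro d hd hpth
  have key : ∀ i : Fin 4, d i = 1 → False := fun i hi => by
    have h := hpth i (by rw [Finsupp.mem_support_iff, hi]; exact one_ne_zero)
    rw [hi] at h
    exact hp.out.one_lt.ne' (Nat.dvd_one.mp h)
  rcases mem_support_Q hd with rfl | rfl | rfl | rfl
  · exact key 1 (by simp)
  · exact key 2 (by simp)
  · exact key 3 (by simp)
  · exact key 0 (by simp)

omit hp [CharP K p] in
/-- Every monomial of `Q` has total degree `p + 1`. [folklore] -/
theorem degree_eq_of_mem_support_Q {d : Fin 4 →₀ ℕ}
    (hd : d ∈ (X 0 ^ p * X 1 + X 1 ^ p * X 2 + X 2 ^ p * X 3 + X 3 ^ p * X 0 : MvPolynomial (Fin 4) K).support) :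
    d.degree = p + 1 := by
  rcases mem_support_Q hd with rfl | rfl | rfl | rfl <;> rw [map_add, Finsupp.degree_single, Finsupp.degree_single]

/-! ## §2 The root equation `F = x₁^p · Q` -/

omit hp [CharP K p] in
/-- `F = x₁^p·Q` as a sum of four monomials. [folklore] -/
theorem inst₆_eq_monomial_add :
    (X 0 ^ p * (X 0 ^ p * X 1 + X 1 ^ p * X 2 + X 2 ^ p * X 3 + X 3 ^ p * X 0) : MvPolynomial (Fin 4) K) =
      monomial (Finsupp.single 0 p + (Finsupp.single 0 p + Finsupp.single 1 1)) 1 +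
        monomial (Finsupp.single 0 p + (Finsupp.single 1 p + Finsupp.single 2 1)) 1 +
        monomial (Finsupp.single 0 p + (Finsupp.single 2 p + Finsupp.single 3 1)) 1 +
        monomial (Finsupp.single 0 p + (Finsupp.single 3 p + Finsupp.single 0 1)) 1 := by
  rw [Q_eq_monomial_add, X_pow_eq_monomial, mul_add, mul_add, mul_add, monomial_mul, monomial_mul, monomial_mul, monomial_mul,
    mul_one]

omit hp [CharP K p] in
/-- The support of `F` lies in its four exponents. [folklore] -/
theorem mem_support_inst₆ {d : Fin 4 →₀ ℕ}
    (hd : d ∈ (X 0 ^ p * (X 0 ^ p * X 1 + X 1 ^ p * X 2 + X 2 ^ p * X 3 + X 3 ^ p * X 0) : MvPolynomial (Fin 4) K).support) :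
    d = Finsupp.single 0 p + (Finsupp.single 0 p + Finsupp.single 1 1) ∨
      d = Finsupp.single 0 p + (Finsupp.single 1 p + Finsupp.single 2 1) ∨
      d = Finsupp.single 0 p + (Finsupp.single 2 p + Finsupp.single 3 1) ∨
      d = Finsupp.single 0 p + (Finsupp.single 3 p + Finsupp.single 0 1) := by
  rw [inst₆_eq_monomial_add] at hd
  rcases Finset.mem_union.mp (Finset.mem_of_subset MvPolynomial.support_add hd) with h₁ | h₁
  · rcases Finset.mem_union.mp (Finset.mem_of_subset MvPolynomial.support_add h₁) with h₂ | h₂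
    · rcases Finset.mem_union.mp (Finset.mem_of_subset MvPolynomial.support_add h₂) with h₃ | h₃
      · exact Or.inl (Finset.mem_singleton.mp (Finset.mem_of_subset support_monomial_subset h₃))
      · exact Or.inr (Or.inl (Finset.mem_singleton.mp (Finset.mem_of_subset support_monomial_subset h₃)))
    · exact Or.inr (Or.inr (Or.inl (Finset.mem_singleton.mp (Finset.mem_of_subset support_monomial_subset h₂))))
  · exact Or.inr (Or.inr (Or.inr (Finset.mem_singleton.mp (Finset.mem_of_subset support_monomial_subset h₁))))

omit [CharP K p] in
/-- `F` is clean (`x₁^{p+1} x₄^p` has the exponent `p + 1`, the other monomials an exponent `1`).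
[cite: HauserPerlega2019PRIMS, §2 (cleaning)] -/
theorem isClean_inst₆ :
    Literature.Barriers.ResolutionOfSingularities.HauserPerlega.IsClean p
      (X 0 ^ p * (X 0 ^ p * X 1 + X 1 ^ p * X 2 + X 2 ^ p * X 3 + X 3 ^ p * X 0) : MvPolynomial (Fin 4) K) := by
  intro d hd hpth
  have key : ∀ i : Fin 4, d i = 1 → False := fun i hi => by
    have h := hpth i (by rw [Finsupp.mem_support_iff, hi]; exact one_ne_zero)
    rw [hi] at h
    exact hp.out.one_lt.ne' (Nat.dvd_one.mp h)
  rcases mem_support_inst₆ hd with rfl | rfl | rfl | rfl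
  · exact key 1 (by simp)
  · exact key 2 (by simp)
  · exact key 3 (by simp)
  · have h0 : (Finsupp.single 0 p + (Finsupp.single 3 p + Finsupp.single 0 1) : Fin 4 →₀ ℕ) 0 = p + 1 := by
      simp
    have h := hpth 0 (by rw [Finsupp.mem_support_iff, h0]; omega)
    rw [h0] at h
    exact hp.out.one_lt.ne' (Nat.dvd_one.mp ((Nat.dvd_add_right (dvd_refl p)).mp h))

omit [CharP K p] in
/-- The coefficient of `x₁^{2p} x₂` in `F` is `1`. [folklore] -/
theorem coeff_inst₆_lead :
    coeff (Finsupp.single (0 : Fin 4) p + (Finsupp.single 0 p + Finsupp.single 1 1))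
      (X 0 ^ p * (X 0 ^ p * X 1 + X 1 ^ p * X 2 + X 2 ^ p * X 3 + X 3 ^ p * X 0) : MvPolynomial (Fin 4) K) = 1 := by
  have hp1 : p ≠ 1 := hp.out.one_lt.ne'
  have h2 : (Finsupp.single (0 : Fin 4) p + (Finsupp.single 1 p + Finsupp.single 2 1)) ≠
      Finsupp.single 0 p + (Finsupp.single 0 p + Finsupp.single 1 1) := fun h => by
    have := DFunLike.congr_fun h 1; simp at this; exact hp1 this
  have h3 : (Finsupp.single (0 : Fin 4) p + (Finsupp.single 2 p + Finsupp.single 3 1)) ≠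
      Finsupp.single 0 p + (Finsupp.single 0 p + Finsupp.single 1 1) := fun h => by
    have := DFunLike.congr_fun h 1; simp at this
  have h4 : (Finsupp.single (0 : Fin 4) p + (Finsupp.single 3 p + Finsupp.single 0 1)) ≠
      Finsupp.single 0 p + (Finsupp.single 0 p + Finsupp.single 1 1) := fun h => by
    have := DFunLike.congr_fun h 1; simp at this
  rw [inst₆_eq_monomial_add, coeff_add, coeff_add, coeff_add, coeff_monomial, if_pos rfl, coeff_monomial, if_neg h2,
    coeff_monomial, if_neg h3, coeff_monomial, if_neg h4, add_zero, add_zero, add_zero]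

omit [CharP K p] in
/-- `F ≠ 0`. [folklore] -/
theorem inst₆_ne_zero :
    (X 0 ^ p * (X 0 ^ p * X 1 + X 1 ^ p * X 2 + X 2 ^ p * X 3 + X 3 ^ p * X 0) : MvPolynomial (Fin 4) K) ≠ 0 := by
  intro h
  have hc := coeff_inst₆_lead (K := K) (p := p)
  rw [h, coeff_zero] at hc
  exact zero_ne_one hc

omit hp [CharP K p] in
/-- **`V(z, x₁)` is Hironaka-permissible for `z^p + F`.** [cite: HauserPerlega2019PRIMS, §2 (condition (1))] -/
theorem isPermissibleCentre_inst₆ :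
    IsPermissibleCentre p ({0} : Finset (Fin 4))
      (X 0 ^ p * (X 0 ^ p * X 1 + X 1 ^ p * X 2 + X 2 ^ p * X 3 + X 3 ^ p * X 0) : MvPolynomial (Fin 4) K) := by
  refine ⟨⟨0, Finset.mem_singleton_self _⟩, Finset.le_inf fun d hd => ?_⟩
  rcases mem_support_inst₆ hd with rfl | rfl | rfl | rfl <;> simp [degIn_singleton_zero]

omit hp [CharP K p] in
/-- **The `x₁`-chart transform of `F` is `Q`** (division by `x₁^p`). [cite: HauserPerlega2019PRIMS, §2 (the x₁-chart)] -/
theorem chartTransform_inst₆ :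
    CentreBlowup.chartTransform p ({0} : Finset (Fin 4)) 0
        (X 0 ^ p * (X 0 ^ p * X 1 + X 1 ^ p * X 2 + X 2 ^ p * X 3 + X 3 ^ p * X 0) : MvPolynomial (Fin 4) K) =
      X 0 ^ p * X 1 + X 1 ^ p * X 2 + X 2 ^ p * X 3 + X 3 ^ p * X 0 := by
  rw [inst₆_eq_monomial_add, CentreBlowup.chartTransform_add, CentreBlowup.chartTransform_add,
    CentreBlowup.chartTransform_monomial_add_monomial, CentreBlowup.chartTransform_monomial, CentreBlowup.chartTransform_monomial]
  simp only [CentreBlowup.chartExponent, degIn_singleton_zero]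
  have e1 : (Finsupp.single 0 p + (Finsupp.single 0 p + Finsupp.single 1 1) : Fin 4 →₀ ℕ).update 0
      ((Finsupp.single 0 p + (Finsupp.single 0 p + Finsupp.single 1 1) : Fin 4 →₀ ℕ) 0 - p) =
        Finsupp.single 0 p + Finsupp.single 1 1 := by
    ext i; fin_cases i <;> simp [Finsupp.update_apply]
  have e2 : (Finsupp.single 0 p + (Finsupp.single 1 p + Finsupp.single 2 1) : Fin 4 →₀ ℕ).update 0
      ((Finsupp.single 0 p + (Finsupp.single 1 p + Finsupp.single 2 1) : Fin 4 →₀ ℕ) 0 - p) =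
        Finsupp.single 1 p + Finsupp.single 2 1 := by
    ext i; fin_cases i <;> simp [Finsupp.update_apply]
  have e3 : (Finsupp.single 0 p + (Finsupp.single 2 p + Finsupp.single 3 1) : Fin 4 →₀ ℕ).update 0
      ((Finsupp.single 0 p + (Finsupp.single 2 p + Finsupp.single 3 1) : Fin 4 →₀ ℕ) 0 - p) =
        Finsupp.single 2 p + Finsupp.single 3 1 := by
    ext i; fin_cases i <;> simp [Finsupp.update_apply]
  have e4 : (Finsupp.single 0 p + (Finsupp.single 3 p + Finsupp.single 0 1) : Fin 4 →₀ ℕ).update 0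
      ((Finsupp.single 0 p + (Finsupp.single 3 p + Finsupp.single 0 1) : Fin 4 →₀ ℕ) 0 - p) =
        Finsupp.single 3 p + Finsupp.single 0 1 := by
    ext i; fin_cases i <;> simp [Finsupp.update_apply]
  rw [e1, e2, e3, e4, Q_eq_monomial_add]

/-- **The root parameters lie on the member**: order `p` at `(a, b)` forces `b₁ = 0` (`∂F/∂x₂ = x₁^{2p}`).
[cite: Hauser2010, §F (equiconstant points)] -/
theorem roots_inst₆ (b : Fin 4 → K)
    (H : ∀ d : Fin 4 →₀ ℕ, d ≠ 0 → d.degree < p → coeff d (PointBlowup.translate b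
      (X 0 ^ p * (X 0 ^ p * X 1 + X 1 ^ p * X 2 + X 2 ^ p * X 3 + X 3 ^ p * X 0) : MvPolynomial (Fin 4) K)) = 0) :
    b 0 = 0 := by
  have h1 := eval_pderiv_eq_zero_of_forall_coeff b _ H 1
  simp [(pderiv (1 : Fin 4)).leibniz_pow, hp.out.ne_zero] at h1
  exact h1

omit [CharP K p] in
/-- **The `F`-component of the leaf state** `step p {x₁} x₁ 0 (F, 0, ∅)` is `Q`. [cite: Hauser2010, §§F–G] -/
theorem step_F_inst₆ [DecidableEq K] :
    (CentreBlowup.step p ({0} : Finset (Fin 4)) 0 0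
        (⟨X 0 ^ p * (X 0 ^ p * X 1 + X 1 ^ p * X 2 + X 2 ^ p * X 3 + X 3 ^ p * X 0), 0, ∅⟩ : State K)).F =
      X 0 ^ p * X 1 + X 1 ^ p * X 2 + X 2 ^ p * X 3 + X 3 ^ p * X 0 := by
  show deletePthPowers p (PointBlowup.translate 0 (CentreBlowup.chartTransform p ({0} : Finset (Fin 4)) 0
    (X 0 ^ p * (X 0 ^ p * X 1 + X 1 ^ p * X 2 + X 2 ^ p * X 3 + X 3 ^ p * X 0) : MvPolynomial (Fin 4) K))) = _
  rw [chartTransform_inst₆, PointBlowup.translate_zero]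
  exact Literature.Barriers.ResolutionOfSingularities.HauserPerlega.deletePthPowers_eq_self isClean_Q

omit hp [CharP K p] in
/-- **The origin of the `x₁`-chart is an equimultiple pair** (`Q` has no monomial of degree `< p`).
[cite: Hauser2010, §F (equiconstant points)] -/
theorem isEquimultiplePoint_inst₆_origin [DecidableEq K] :
    CentreBlowup.IsEquimultiplePoint p ({0} : Finset (Fin 4)) 0 0
      (⟨X 0 ^ p * (X 0 ^ p * X 1 + X 1 ^ p * X 2 + X 2 ^ p * X 3 + X 3 ^ p * X 0), 0, ∅⟩ : State K) := by
  intro d hd hdp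
  unfold CentreBlowup.pointTransform
  rw [show (⟨X 0 ^ p * (X 0 ^ p * X 1 + X 1 ^ p * X 2 + X 2 ^ p * X 3 + X 3 ^ p * X 0), 0, ∅⟩ : State K).F =
      X 0 ^ p * (X 0 ^ p * X 1 + X 1 ^ p * X 2 + X 2 ^ p * X 3 + X 3 ^ p * X 0) from rfl, chartTransform_inst₆,
    PointBlowup.translate_zero]
  by_contra hne
  have := degree_eq_of_mem_support_Q (MvPolynomial.mem_support_iff.mpr hne)
  omega

/-- **The ONLY equimultiple point of the `x₁`-chart is the origin** (`∂Q/∂x₃ = x₂^p`, `∂Q/∂x₄ = x₃^p`, `∂Q/∂x₁ = x₄^p`).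
[cite: Hauser2010, §F (equiconstant points)] -/
theorem eq_zero_of_isEquimultiplePoint_inst₆ [DecidableEq K] {b : Fin 4 → K} (hb0 : b 0 = 0)
    (h : CentreBlowup.IsEquimultiplePoint p ({0} : Finset (Fin 4)) 0 b
      (⟨X 0 ^ p * (X 0 ^ p * X 1 + X 1 ^ p * X 2 + X 2 ^ p * X 3 + X 3 ^ p * X 0), 0, ∅⟩ : State K)) : b = 0 := by
  unfold CentreBlowup.IsEquimultiplePoint CentreBlowup.pointTransform at h
  rw [show (⟨X 0 ^ p * (X 0 ^ p * X 1 + X 1 ^ p * X 2 + X 2 ^ p * X 3 + X 3 ^ p * X 0), 0, ∅⟩ : State K).F =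
      X 0 ^ p * (X 0 ^ p * X 1 + X 1 ^ p * X 2 + X 2 ^ p * X 3 + X 3 ^ p * X 0) from rfl, chartTransform_inst₆] at h
  have h0 := eval_pderiv_eq_zero_of_forall_coeff b _ h 0
  have h2 := eval_pderiv_eq_zero_of_forall_coeff b _ h 2
  have h3 := eval_pderiv_eq_zero_of_forall_coeff b _ h 3
  simp [(pderiv (0 : Fin 4)).leibniz_pow, (pderiv (2 : Fin 4)).leibniz_pow, (pderiv (3 : Fin 4)).leibniz_pow,
    hp.out.ne_zero] at h0 h2 h3
  funext i
  fin_cases i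
  · exact hb0
  · exact h2
  · exact h3
  · exact h0

end Instance₆

end Equimultiple

end Summit.ResolutionOfSingularities.ResolutionOfSingularities.Theorems.PIDim4

end
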